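/-
Copyright (c) 2026 the pub-hodgecm-mathlib formalisation cell (harness21).  Prover seat hodgecm-mathlib-K2E3-p12 (g8), Track B ∕ K2-LIT, h413 = `stmt-HodgeConjecture-24833`,
line `K2_E1_TraceFormulaBeta`, 5Res ROADCARD «ENDGAME BY FAMILIES» (K2E1-plan (g7), (154)) file C1 «f3-χ» (deal (142)), part W-a: the `K_U`-AVERAGES ALONG THE TORUS of `χ`-sections of
`U(J₂)` — the (χ,τ)-input of ★ (δ)₂ `K2E1EisensteinPairingUnfoldedWeightU2` for the twisted pseudo-Eisenstein inner product formula.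
-/
import Summits.HodgeConjecture.HodgeConjecture.Theorems.K2E1ChiIntertwinedSectionU2                 -- ★ row 3 (K2-defs1 g6): χ-sections, torus scaling of the intertwining integral, `chi_torus_snd_eq_reflectChar`
import Summits.HodgeConjecture.HodgeConjecture.Theorems.K2E1ChiSectionSpaceU2Defs                   -- ★ `firstEntryUnit_eq_diagUnit_zero`
import Summits.HodgeConjecture.HodgeConjecture.Theorems.K2E1EisensteinPairingUnfoldedU2            -- ★ `torusRootModulus_diagUnit_torus_eq_ideleNorm_two`
import Summits.HodgeConjecture.HodgeConjecture.Theorems.K2E1BorelParabolicIntegralU2               -- ★ `borelHeight_coe_eq_ideleNorm_diagUnit`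
import Literature.NumberTheory.Automorphic.UnitaryGroupBorelTorusUnipotentCoordinates               -- ★ `glDiagonal_diagUnit_torus`
import Literature.NumberTheory.Automorphic.UnitaryGroupCuspIntegralSiegelMajorant                   -- ★ `borelHeight_mul_of_mem_comap_standardMaximalCompactGL`
import HarnessLib

/-!
# C1 «f3-χ», part W-a — `K2E1ChiSectionTorusAverageU2`: THE `K_U`-AVERAGES ALONG `t·K_U` OF `χ`-SECTION DATA OF `U(J₂)` — `φ(t k) = χ(d₀(t))·φ(k)`, the torus scaling of the
# intertwining integral in `d₀`-currency, and the two averages `∫_{K_U} g₁(H)·φ·conj(g₂(H)·φ′)`, `∫_{K_U} g₁(H)·φ·conj(∫_ℝ G·M(·))` along `t·K_U` (the `hΨΦ` data of ★ (δ)₂)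

Track B ∕ K2-LIT, crux h413 = `stmt-HodgeConjecture-24833`, route of record `HCCMUnconditional`; cell `hodgecm-mathlib`, squad K2, ENGINE E1.  THEOREMS ONLY (no `def`, no `instance`,
no `notation`, no named-fact hypothesis, no `sorry`); lane `--supports stmt-HodgeConjecture-24833 --as helper` (count-neutral).  Generic quadratic datum `(F, E, c)`, `N = 2`.
THE MATHEMATICS ([MoeglinWaldspurger1995, II.1.6–II.1.7, II.2.1]; [GelbartRogawski1991, §3.1]; [Rogawski1990, §7.3 pp. 96–98]).  In the unfolded inner product of two twisted
pseudo-Eisenstein series `θ_{f,φ}`, `θ_{f′,φ′}` (★ D0-χ `K2E1ChiPseudoEisensteinRadialCMTwo`, ROADCARD (154) §1) the `B(F)`-weight-level integrand `Ψ` is pushed to the idele classes by ★ (δ)₂,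
whose only non-structural input is the `K_U`-AVERAGE `t ↦ ∫_{K_U} Ψ(t k) dμ_K` as a function `Φ(d₀ t)` of the first diagonal idele `d₀ t`.  For `χ`-SECTION data this average is explicit:
(§1) a `χ`-section satisfies `φ(t y) = χ(d₀ t)·φ(y)` (`b₀₀ = d₀`, ★ `IsChiSection.borel_mul`, ★ `firstEntryUnit_eq_diagUnit_zero`) and `H(t k) = ‖d₀ t‖` (★); (§2) the intertwining integral
`I(z, g) := ∫_{N(𝔸)} (φ·H^z)(w₀ v g) dν` scales by `I(z, t y) = ‖d₀‖·χʷ(d₀)·(‖d₀‖⁻¹)^z·I(z, y)` (★ row 3 `integral_flatSectionU_weylLongU_torus_mul_of_isChiSection` with `δ_B(t) = ‖d₀‖` ★,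
`χ(d₁) = χʷ(d₀)` ★, in the `d₀ = diagUnit t 0` currency of ★ (δ)₂); (§3) hence along `t·K_U`:
`∫ g₁(H(tk))·φ(tk)·conj(g₂(H(tk))·φ′(tk)) dμ_K = g₁(‖d₀‖)·conj g₂(‖d₀‖)·χ(d₀)·conj χ′(d₀)·⟪φ, φ′⟫_K` (`⟪φ,φ′⟫_K = ∫_{K_U} φ·conj φ′`) and
`∫ g₁(H(tk))·φ(tk)·conj(∫_ℝ G(y)·I_{φ′}(σ₀+iy, tk) dy) dμ_K = g₁(‖d₀‖)·χ(d₀)·∫_{K_U} φ(k)·conj(∫_ℝ G(y)·(‖d₀‖·χ′ʷ(d₀)·(‖d₀‖⁻¹)^{σ₀+iy})·I_{φ′}(σ₀+iy, k) dy) dμ_K` — POINTWISE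
rewrites under the integral signs (no Fubini, no convergence hypothesis): the character factors `χ·conj χ′` and `χ·conj χ′ʷ` of ROADCARD (154) §1 (OD)∕(SD)∕(XF) appear here.
* §1 `apply_torus_mul_of_isChiSection`, `borelHeight_torus_mul_maximalCompact`.  * §2 `integral_flatSectionU_weylLongU_torus_mul_eq_diagUnit`.
* §3 **`integral_maximalCompact_torus_chiSection_mul_conj`**, **`integral_maximalCompact_torus_chiSection_mul_conj_intertwined`**.
HONEST LABEL: HC_CM is proved only modulo the 7 printed citations (2 remaining named inputs: hLiu418 = `stmt-HodgeConjecture-24832`, h413 = `stmt-HodgeConjecture-24833`) until rung 0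
closes; this file asserts no named fact, closes no socket; count-neutral; letter-free.

## References
* [MoeglinWaldspurger1995] C. Mœglin, J.-L. Waldspurger, *Spectral decomposition and Eisenstein series* (1995), II.1.6–II.1.7, II.2.1.
* [GelbartRogawski1991] S. Gelbart, J. Rogawski, *L-functions and Fourier–Jacobi coefficients for the unitary group U(3)*, Invent. Math. 105 (1991), §3.1.
* [Rogawski1990] J. D. Rogawski, *Automorphic Representations of Unitary Groups in Three Variables* (1990), §7.3 pp. 96–98.
-/

set_option autoImplicit false
set_option linter.dupNamespace false  -- the mandated namespace repeats the summit's segment (`HodgeConjecture.HodgeConjecture`)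

noncomputable section

open MeasureTheory Measure NumberField IsDedekindDomain Matrix
open scoped ENNReal NNReal MatrixGroups ComplexConjugate
open Literature.NumberTheory Literature.NumberTheory.Automorphic Literature.NumberTheory.Automorphic.UnitaryGroup AdelicGroupData
open Literature.NumberTheory.GaloisRepresentations (HeckeCharacter ideleGroup)
open Summit.HodgeConjecture.HodgeConjecture.Cruxes.H413.K2E1BorelEisensteinU
open Summit.HodgeConjecture.HodgeConjecture.Cruxes.H413.K2E1CharacterEisensteinU2Defs
open Summit.HodgeConjecture.HodgeConjecture.Cruxes.H413.K2E1ChiSectionSpaceU2Defs (firstEntryUnit_eq_diagUnit_zero)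
open Summit.HodgeConjecture.HodgeConjecture.Cruxes.H413.K2E1ChiIntertwinedSectionU2 (integral_flatSectionU_weylLongU_torus_mul_of_isChiSection chi_torus_snd_eq_reflectChar)
open Summit.HodgeConjecture.HodgeConjecture.Cruxes.H413.K2E1EisensteinPairingUnfoldedU2 (torusRootModulus_diagUnit_torus_eq_ideleNorm_two)
open Summit.HodgeConjecture.HodgeConjecture.Cruxes.H413.K2E1BorelParabolicIntegralU2 (borelHeight_coe_eq_ideleNorm_diagUnit)

namespace Summit.HodgeConjecture.HodgeConjecture.Cruxes.H413.K2E1ChiSectionTorusAverageU2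

variable {F E : Type} [Field F] [NumberField F] [Field E] [NumberField E] [Algebra F E] {c : E ≃ₐ[F] E}

/-! ## §1 `χ`-sections along the torus: `φ(t y) = χ(d₀ t)·φ(y)`; `H(t k) = ‖d₀ t‖` -/

/-- **`φ(t y) = χ(d₀ t)·φ(y)`** for a `χ`-section `φ` and `t ∈ T(𝔸_F)` (`t₀₀ = d₀ t`, ★ `IsChiSection.borel_mul`, ★ `firstEntryUnit_eq_diagUnit_zero`). [cite: MoeglinWaldspurger1995, II.1.7] -/
theorem apply_torus_mul_of_isChiSection {χ : HeckeCharacter E} {φ : (quasiSplit F E c 2).Adelic → ℂ} (hφ : IsChiSection χ φ) (t : ↥(torusInBorel F E c 2)) (y : (quasiSplit F E c 2).Adelic) :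
    φ (((t : borelAdelic F E c 2) : (quasiSplit F E c 2).Adelic) * y) = ((χ (diagUnit (t : borelAdelic F E c 2).2 0) : ℂˣ) : ℂ) * φ y := by
  rw [hφ.borel_mul (t : borelAdelic F E c 2).2, firstEntryUnit_eq_diagUnit_zero]

/-- **`H(t k) = ‖d₀ t‖`** for `t ∈ T(𝔸_F)`, `k ∈ K_U` (★ `borelHeight_mul_of_mem_comap_standardMaximalCompactGL`, ★ `borelHeight_coe_eq_ideleNorm_diagUnit`). [cite: Rogawski1990, §2.2 (p. 13)] -/
theorem borelHeight_torus_mul_maximalCompact (t : ↥(torusInBorel F E c 2))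
    (k : ((standardMaximalCompactGL 2 E).comap (adelicVal F E c 2 ((StdForm.antidiagonal 2).over E)) : Subgroup (quasiSplit F E c 2).Adelic)) :
    borelHeight (((t : borelAdelic F E c 2) : (quasiSplit F E c 2).Adelic) * (k : (quasiSplit F E c 2).Adelic)) = IdeleClassGroup.ideleNorm E (diagUnit (t : borelAdelic F E c 2).2 0) := by
  rw [borelHeight_mul_of_mem_comap_standardMaximalCompactGL k.2, borelHeight_coe_eq_ideleNorm_diagUnit]

/-! ## §2 Torus scaling of the intertwining integral of a `χ`-section, `d₀`-currency -/

variable [MeasurableSpace (quasiSplit F E c 2).Adelic] [BorelSpace (quasiSplit F E c 2).Adelic]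

/-- **`I(z, t y) = ‖d₀‖·χʷ(d₀)·(‖d₀‖⁻¹)^z·I(z, y)`**, `I(z, g) = ∫_{N(𝔸)} (φ·H^z)(w₀ v g) dν`, `d₀ = d₀ t`, for a Borel `χ`-section `φ` of `U(J₂)` (`c² = 1`, `c ≠ 1`), a Haar `ν` on `N(𝔸)`, every `z`,
`t ∈ T(𝔸_F)`, `y` — ★ row 3 `integral_flatSectionU_weylLongU_torus_mul_of_isChiSection` at `d = diagUnit t` (★ `glDiagonal_diagUnit_torus`) with `δ_B(t) = ‖d₀‖` (★
`torusRootModulus_diagUnit_torus_eq_ideleNorm_two`) and `χ(d₁) = χʷ(d₀)` (★ `chi_torus_snd_eq_reflectChar`). [cite: MoeglinWaldspurger1995, II.1.6] [cite: GelbartRogawski1991, §3.1] -/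
theorem integral_flatSectionU_weylLongU_torus_mul_eq_diagUnit (hc : c * c = 1) (hc1 : c ≠ 1) (ν : Measure ↥(adelicUnipotent F E c 2)) [ν.IsHaarMeasure]
    {χ : HeckeCharacter E} {φ : (quasiSplit F E c 2).Adelic → ℂ} (hφ : IsChiSection χ φ) (hφm : Measurable φ) (t : ↥(torusInBorel F E c 2)) (z : ℂ) (y : (quasiSplit F E c 2).Adelic) :
    ∫ v : ↥(adelicUnipotent F E c 2), flatSectionU φ z ((quasiSplit F E c 2).toAdelic (weylLongU (c : E →+* E) (rfl : (StdForm.antidiagonal 2).over E = (StdForm.antidiagonal 2).over E)) *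
        ((v : (quasiSplit F E c 2).Adelic) * (((t : borelAdelic F E c 2) : (quasiSplit F E c 2).Adelic) * y))) ∂ν =
      (((IdeleClassGroup.ideleNorm E (diagUnit (t : borelAdelic F E c 2).2 0) : ℝ≥0) : ℝ) : ℂ) *
        (((reflectChar c χ (diagUnit (t : borelAdelic F E c 2).2 0) : ℂˣ) : ℂ) * ((((IdeleClassGroup.ideleNorm E (diagUnit (t : borelAdelic F E c 2).2 0))⁻¹ : ℝ≥0) : ℝ) : ℂ) ^ z) *
        ∫ v : ↥(adelicUnipotent F E c 2), flatSectionU φ z ((quasiSplit F E c 2).toAdelic (weylLongU (c : E →+* E) (rfl : (StdForm.antidiagonal 2).over E = (StdForm.antidiagonal 2).over E)) *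
          ((v : (quasiSplit F E c 2).Adelic) * y)) ∂ν := by
  have hd := glDiagonal_diagUnit_torus (F := F) (E := E) (c := c) (N := 2) t
  rw [integral_flatSectionU_weylLongU_torus_mul_of_isChiSection hc hc1 ν hφ hφm t hd z y, torusRootModulus_diagUnit_torus_eq_ideleNorm_two, chi_torus_snd_eq_reflectChar χ t hd]

/-! ## §3 The two `K_U`-averages along `t·K_U` (the `hΨΦ` data of ★ (δ)₂ for `χ`-section data) -/

omit [BorelSpace (quasiSplit F E c 2).Adelic] in
/-- **`∫_{K_U} g₁(H(tk))·φ(tk)·conj(g₂(H(tk))·φ′(tk)) dμ_K = g₁(‖d₀‖)·conj g₂(‖d₀‖)·(χ(d₀)·conj χ′(d₀))·∫_{K_U} φ·conj φ′ dμ_K`** for `χ`-, `χ′`-sections `φ, φ′`, any `g₁, g₂ : ℝ → ℂ`, any measure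
`μ_K` on `K_U`, every `t ∈ T(𝔸_F)` — the `w = 1` term's `K_U`-average; character factor `χ·conj χ′` (a norm twist iff `χ′ = χ` up to `‖·‖^{it}`). [cite: MoeglinWaldspurger1995, II.2.1] [cite: Rogawski1990, §7.3] -/
theorem integral_maximalCompact_torus_chiSection_mul_conj
    (μK : Measure ((standardMaximalCompactGL 2 E).comap (adelicVal F E c 2 ((StdForm.antidiagonal 2).over E)) : Subgroup (quasiSplit F E c 2).Adelic))
    {χ χ' : HeckeCharacter E} {φ φ' : (quasiSplit F E c 2).Adelic → ℂ} (hφ : IsChiSection χ φ) (hφ' : IsChiSection χ' φ') (g₁ g₂ : ℝ → ℂ) (t : ↥(torusInBorel F E c 2)) :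
    ∫ k : ((standardMaximalCompactGL 2 E).comap (adelicVal F E c 2 ((StdForm.antidiagonal 2).over E)) : Subgroup (quasiSplit F E c 2).Adelic),
        g₁ (borelHeight (((t : borelAdelic F E c 2) : (quasiSplit F E c 2).Adelic) * (k : (quasiSplit F E c 2).Adelic)) : ℝ) *
          φ (((t : borelAdelic F E c 2) : (quasiSplit F E c 2).Adelic) * (k : (quasiSplit F E c 2).Adelic)) *
          conj (g₂ (borelHeight (((t : borelAdelic F E c 2) : (quasiSplit F E c 2).Adelic) * (k : (quasiSplit F E c 2).Adelic)) : ℝ) *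
            φ' (((t : borelAdelic F E c 2) : (quasiSplit F E c 2).Adelic) * (k : (quasiSplit F E c 2).Adelic))) ∂μK =
      g₁ (IdeleClassGroup.ideleNorm E (diagUnit (t : borelAdelic F E c 2).2 0) : ℝ) * conj (g₂ (IdeleClassGroup.ideleNorm E (diagUnit (t : borelAdelic F E c 2).2 0) : ℝ)) *
        (((χ (diagUnit (t : borelAdelic F E c 2).2 0) : ℂˣ) : ℂ) * conj (((χ' (diagUnit (t : borelAdelic F E c 2).2 0) : ℂˣ) : ℂ))) *
        ∫ k : ((standardMaximalCompactGL 2 E).comap (adelicVal F E c 2 ((StdForm.antidiagonal 2).over E)) : Subgroup (quasiSplit F E c 2).Adelic),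
          φ (k : (quasiSplit F E c 2).Adelic) * conj (φ' (k : (quasiSplit F E c 2).Adelic)) ∂μK := by
  rw [← integral_const_mul]
  refine integral_congr_ae (Filter.Eventually.of_forall fun k => ?_)
  simp only [borelHeight_torus_mul_maximalCompact t k, apply_torus_mul_of_isChiSection hφ t, apply_torus_mul_of_isChiSection hφ' t, map_mul]
  ring

/-- **THE INTERTWINED TERM'S `K_U`-AVERAGE**: for a `χ`-section `φ`, a Borel `χ′`-section `φ′`, `g₁ : ℝ → ℂ`, `G : ℝ → ℂ`, `σ₀ : ℝ` and `t ∈ T(𝔸_F)`, with `I(z, g) := ∫_{N(𝔸)} (φ′·H^z)(w₀ v g) dν`: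
`∫_{K_U} g₁(H(tk))·φ(tk)·conj(∫_ℝ G(y)·I(σ₀+iy, tk) dy) dμ_K = g₁(‖d₀‖)·χ(d₀)·∫_{K_U} φ(k)·conj(∫_ℝ G(y)·(‖d₀‖·χ′ʷ(d₀)·(‖d₀‖⁻¹)^{σ₀+iy})·I(σ₀+iy, k) dy) dμ_K` — POINTWISE rewrites (§1, §2) under the two
integral signs; character factor `χ·conj χ′ʷ` (a norm twist iff `χ′ = χʷ` up to `‖·‖^{it}`: the `w = w₀` term lives on the ASSOCIATE family). [cite: MoeglinWaldspurger1995, II.2.1] [cite: Rogawski1990, §7.3] -/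
theorem integral_maximalCompact_torus_chiSection_mul_conj_intertwined (hc : c * c = 1) (hc1 : c ≠ 1) (ν : Measure ↥(adelicUnipotent F E c 2)) [ν.IsHaarMeasure]
    (μK : Measure ((standardMaximalCompactGL 2 E).comap (adelicVal F E c 2 ((StdForm.antidiagonal 2).over E)) : Subgroup (quasiSplit F E c 2).Adelic))
    {χ χ' : HeckeCharacter E} {φ φ' : (quasiSplit F E c 2).Adelic → ℂ} (hφ : IsChiSection χ φ) (hφ' : IsChiSection χ' φ') (hφ'm : Measurable φ')
    (g₁ : ℝ → ℂ) (G : ℝ → ℂ) (σ₀ : ℝ) (t : ↥(torusInBorel F E c 2)) :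
    ∫ k : ((standardMaximalCompactGL 2 E).comap (adelicVal F E c 2 ((StdForm.antidiagonal 2).over E)) : Subgroup (quasiSplit F E c 2).Adelic),
        g₁ (borelHeight (((t : borelAdelic F E c 2) : (quasiSplit F E c 2).Adelic) * (k : (quasiSplit F E c 2).Adelic)) : ℝ) *
          φ (((t : borelAdelic F E c 2) : (quasiSplit F E c 2).Adelic) * (k : (quasiSplit F E c 2).Adelic)) *
          conj (∫ y : ℝ, G y * ∫ v : ↥(adelicUnipotent F E c 2), flatSectionU φ' ((σ₀ : ℂ) + y * Complex.I)
            ((quasiSplit F E c 2).toAdelic (weylLongU (c : E →+* E) (rfl : (StdForm.antidiagonal 2).over E = (StdForm.antidiagonal 2).over E)) *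
              ((v : (quasiSplit F E c 2).Adelic) * (((t : borelAdelic F E c 2) : (quasiSplit F E c 2).Adelic) * (k : (quasiSplit F E c 2).Adelic)))) ∂ν) ∂μK =
      g₁ (IdeleClassGroup.ideleNorm E (diagUnit (t : borelAdelic F E c 2).2 0) : ℝ) * ((χ (diagUnit (t : borelAdelic F E c 2).2 0) : ℂˣ) : ℂ) *
        ∫ k : ((standardMaximalCompactGL 2 E).comap (adelicVal F E c 2 ((StdForm.antidiagonal 2).over E)) : Subgroup (quasiSplit F E c 2).Adelic),
          φ (k : (quasiSplit F E c 2).Adelic) *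
            conj (∫ y : ℝ, G y * ((((IdeleClassGroup.ideleNorm E (diagUnit (t : borelAdelic F E c 2).2 0) : ℝ≥0) : ℝ) : ℂ) *
              (((reflectChar c χ' (diagUnit (t : borelAdelic F E c 2).2 0) : ℂˣ) : ℂ) * ((((IdeleClassGroup.ideleNorm E (diagUnit (t : borelAdelic F E c 2).2 0))⁻¹ : ℝ≥0) : ℝ) : ℂ) ^ ((σ₀ : ℂ) + y * Complex.I)) *
              ∫ v : ↥(adelicUnipotent F E c 2), flatSectionU φ' ((σ₀ : ℂ) + y * Complex.I)
                ((quasiSplit F E c 2).toAdelic (weylLongU (c : E →+* E) (rfl : (StdForm.antidiagonal 2).over E = (StdForm.antidiagonal 2).over E)) * ((v : (quasiSplit F E c 2).Adelic) * (k : (quasiSplit F E c 2).Adelic))) ∂ν)) ∂μK := by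
  rw [← integral_const_mul]
  refine integral_congr_ae (Filter.Eventually.of_forall fun k => ?_)
  simp only [borelHeight_torus_mul_maximalCompact t k, apply_torus_mul_of_isChiSection hφ t, integral_flatSectionU_weylLongU_torus_mul_eq_diagUnit hc hc1 ν hφ' hφ'm t]
  ring

end Summit.HodgeConjecture.HodgeConjecture.Cruxes.H413.K2E1ChiSectionTorusAverageU2

end
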